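import Literature.NumberTheory.QuadraticForms.HilbertSymbolBilinear
import Literature.NumberTheory.QuadraticForms.HilbertSymbolNonDyadic
import Literature.NumberTheory.EllipticCurves.TwoDescentHalvingGalois
import Literature.NumberTheory.EllipticCurves.TwoDescentKummerBridgeConverse
import HarnessLib

/-!
# The Hilbert-symbol Tate quadratic form of a split `2`-descent vanishes on local Kummer images

Topic `NumberTheory/EllipticCurves`; namespace `Literature.NumberTheory.EllipticCurves.TwoDescentHilbert`.
Theorems only (no definition, no named fact).

Let `E : (y + …)² = (x - e₁)(x - e₂)(x - e₃)` be an elliptic curve with rational `2`-torsion over a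
number field `K` and `v` a finite place, `K_v = v.adicCompletion K`.  The complete `2`-descent map
`δ(P) = (x(P) - e₁, x(P) - e₂) ∈ (K_vˣ/K_vˣ²)²` (Silverman, *AEC* X.1.4; the tree's
`WeierstrassCurve.Affine.Point.twoDescentComponent`) lands in `H¹(K_v, E[2]) ≅ (K_vˣ/K_vˣ²)²`, whose
local Tate pairing is `⟨(a, b), (a', b')⟩_v = (a, b')_v (a', b)_v` (Hilbert symbols).  A quadratic
refinement of this pairing that is the SAME for every quadratic twist `E^{(d)}` (whose `2`-torsion
abscissae are `d e₁, d e₂, d e₃`) is the **Hilbert-symbol Tate quadratic form**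

  `Q_v(a, b) = (a, b)_v · (a, D₂)_v · (b, D₁)_v`,  `D₁ = (e₁ - e₂)(e₁ - e₃)`, `D₂ = (e₂ - e₁)(e₂ - e₃)`

(`D₁, D₂` are the descent components of `T₁, T₂`; they scale by `d²` under twisting).  THIS FILE
proves that `Q_v` **vanishes identically on the local Kummer image `δ(E(K_v))`** at every finite
place, dyadic places included (`hilbertSymbol_twoDescentComponent_pair_eq_one`), i.e. the local Kummer
condition is totally isotropic for `Q_v` — the input "`q_v(H¹_𝒮(K_v, T)) = 0`" of a quadratic Selmer
structure in the sense of Klagsbrun–Mazur–Rubin (Ann. of Math. 178 (2013), Def. 3.8; tree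
`Literature/NumberTheory/EllipticCurves/QuadraticSelmerStructure.lean`), here for `T = E[2]` split and
with an EXPLICIT Hilbert-symbol form instead of the Poonen–Rains Heisenberg form.

The proof is elementary: the identity `(a, b)_F = (a + b, -ab)_F` (`a + b ≠ 0`, any field with
`2 ≠ 0`; `hilbertSymbol_eq_add_neg_mul`, from the isometry `⟨a, b⟩ ≅ ⟨a + b, (a + b)ab⟩`) gives over
`K_v`, where the symbol is bimultiplicative (tree `hilbertSymbol_adicCompletion_mul_left`, O'Meara 63:13a),
`(a, b)_v = (a, -(a - b))_v (b, a - b)_v` (`hilbertSymbol_adicCompletion_eq_of_sub_ne_zero`); applied to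
the three pairs among `x - e₁, x - e₂, x - e₃` (pairwise differences `eⱼ - eᵢ`, product a square) it
yields `Q_v(δ(P)) = 1`; at the `2`-torsion points it reduces to `(D₁, D₂)_v = 1`
(`hilbertSymbol_descentConstants_eq_one`).

Motivation: crux `stmt-BirchSwinnertonDyer-27478` (R″ torsion cell), LINE 49 stub D0≤2 — the parity of
`dim Sel⁽²⁾` of the genus twist `E₀^{(−p₀q₁q₂)}` via KMR Thm. 3.9 / Prop. 2.4 (tree
`Literature.LinearAlgebra.QuadraticForm.threeLagrangianParity`) with this form and Hilbert reciprocity.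

## References

* [KlagsbrunMazurRubin2013] Z. Klagsbrun, B. Mazur, K. Rubin, *Disparity in Selmer ranks of quadratic
  twists of elliptic curves*, Ann. of Math. 178 (2013), §3 (Def. 3.2, Def. 3.3, Def. 3.8).
* [PoonenRains2012] B. Poonen, E. Rains, *Random maximal isotropic subspaces and Selmer groups*,
  J. Amer. Math. Soc. 25 (2012), §4 (Prop. 4.8, Prop. 4.10).
* [SilvermanAEC2009] J. H. Silverman, *The Arithmetic of Elliptic Curves*, 2nd ed., GTM 106, Prop. X.1.4.
* [Omeara1963] O. T. O'Meara, *Introduction to quadratic forms*, §63B (63:10, 63:13a).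
* [Serre1973] J.-P. Serre, *A Course in Arithmetic*, Ch. III §1.1, Prop. 2.
-/

noncomputable section

open scoped Classical

open NumberField IsDedekindDomain
open Literature.NumberTheory.QuadraticForms
open WeierstrassCurve WeierstrassCurve.Affine WeierstrassCurve.Affine.Point

namespace Literature.NumberTheory.EllipticCurves.TwoDescentHilbert

/-! ## Identities of the Hilbert symbol over a field -/

section Field

variable {F : Type*} [Field F]

/-- The Hilbert symbol is `±1` (O'Meara §63B), so its square is `1`. [cite: Omeara1963, §63B] -/
theorem hilbertSymbol_mul_self_eq_one (a b : F) : hilbertSymbol F a b * hilbertSymbol F a b = 1 := by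
  rcases hilbertSymbol_eq_one_or_eq_neg_one a b with h | h <;> rw [h] <;> norm_num

/-- **`(a, b)_F = (a + b, (a + b) a b)_F` for `a + b ≠ 0`** over any field: the binary form `⟨a, b⟩`
represents `a + b` (at `x = y = 1`) and has discriminant `ab`, so `⟨a, b⟩ ≅ ⟨a + b, (a + b) a b⟩`
(explicitly `a (X + bY)² + b (X - aY)² = (a + b) X² + (a + b) a b Y²`), and the Hilbert symbol asks
whether the form represents `1`. [cite: Omeara1963, §63B] [cite: Serre1973, III §1.1 Prop. 2] -/
theorem hilbertSymbol_eq_add_mul (a b : F) (hab : a + b ≠ 0) :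
    hilbertSymbol F a b = hilbertSymbol F (a + b) ((a + b) * (a * b)) := by
  have key : (∃ x y : F, a * x ^ 2 + b * y ^ 2 = 1) ↔
      ∃ x y : F, (a + b) * x ^ 2 + (a + b) * (a * b) * y ^ 2 = 1 := by
    constructor
    · rintro ⟨x, y, h⟩
      refine ⟨(a * x + b * y) / (a + b), (x - y) / (a + b), ?_⟩
      have e : (a + b) * ((a * x + b * y) / (a + b)) ^ 2 + (a + b) * (a * b) * ((x - y) / (a + b)) ^ 2 =
          a * x ^ 2 + b * y ^ 2 := by
        field_simp
        ring
      rw [e, h]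
    · rintro ⟨X, Y, h⟩
      exact ⟨X + b * Y, X - a * Y, by linear_combination h⟩
  by_cases h : ∃ x y : F, a * x ^ 2 + b * y ^ 2 = 1
  · rw [(hilbertSymbol_eq_one_iff _ _).2 h, (hilbertSymbol_eq_one_iff _ _).2 (key.1 h)]
  · rw [(hilbertSymbol_eq_neg_one_iff _ _).2 h,
      (hilbertSymbol_eq_neg_one_iff _ _).2 fun h' ↦ h (key.2 h')]

/-- **`(a, b)_F = (a + b, -ab)_F` for `a + b ≠ 0`** in a field with `2 ≠ 0` (Serre, *A Course in
Arithmetic*, III §1.1: `(a, b) = (a + b, -ab)`): `hilbertSymbol_eq_add_mul` and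
`(c, c t)_F = (c, -t)_F` (`hilbertSymbol_neg_mul_right`). [cite: Serre1973, III §1.1 Prop. 2] -/
theorem hilbertSymbol_eq_add_neg_mul [NeZero (2 : F)] (a b : F) (hab : a + b ≠ 0) :
    hilbertSymbol F a b = hilbertSymbol F (a + b) (-(a * b)) := by
  rw [hilbertSymbol_eq_add_mul a b hab, ← hilbertSymbol_neg_mul_right hab (-(a * b))]
  congr 1
  ring

/-- If the class of the unit `A` in `Fˣ/Fˣ²` is the square class of `a ≠ 0`, Hilbert symbols with `A`
and with `a` agree: the symbol only depends on square classes (O'Meara §63B, "the first two of these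
formulas are trivial"). [cite: Omeara1963, §63B] -/
theorem hilbertSymbol_eq_of_mk_eq_sqClass {A : Fˣ} {a : F} (ha : a ≠ 0)
    (h : (QuotientGroup.mk A : SqUnits F) = sqClass a) (w : F) :
    hilbertSymbol F (A : F) w = hilbertSymbol F a w := by
  rw [sqClass_of_ne_zero ha, QuotientGroup.eq] at h
  obtain ⟨C, hC⟩ := h
  rw [powMonoidHom_apply] at hC
  have haC : a = (A : F) * (C : F) ^ 2 := by
    have hval := congrArg Units.val hC
    rw [Units.val_pow_eq_pow_val, Units.val_mul, Units.val_inv_eq_inv_val, Units.val_mk0] at hval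
    field_simp at hval
    linear_combination -hval
  rw [haC, hilbertSymbol_mul_sq_left _ _ C.ne_zero]

/-- A unit whose class in `Fˣ/Fˣ²` is trivial (a square) has all Hilbert symbols equal to `1`
(O'Meara §63B). [cite: Omeara1963, §63B] -/
theorem hilbertSymbol_eq_one_of_mk_eq_one {A : Fˣ} (h : (QuotientGroup.mk A : SqUnits F) = 1) (w : F) :
    hilbertSymbol F (A : F) w = 1 := by
  rw [QuotientGroup.eq_one_iff] at h
  obtain ⟨C, hC⟩ := MonoidHom.mem_range.mp h
  refine hilbertSymbol_eq_one_of_isSquare (a := (A : F)) ⟨(C : F), ?_⟩ A.ne_zero w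
  rw [← hC, powMonoidHom_apply, Units.val_pow_eq_pow_val, pow_two]

end Field

/-! ## Over the completion `K_v`: the difference identity and the descent form -/

section Local

variable (K : Type) [Field K] [NumberField K] (v : HeightOneSpectrum (𝓞 K))

/-- **`(a, b)_v = (a, -(a - b))_v · (b, a - b)_v`** for `a, b, a - b ≠ 0` in `K_v` (dyadic places
included): `(a, -b)_v = (a - b, ab)_v` (`hilbertSymbol_eq_add_neg_mul`) expanded by bimultiplicativity
(tree `hilbertSymbol_adicCompletion_mul_right`, O'Meara 63:13a). [cite: Omeara1963, §63B (63:10, 63:13a)]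
[cite: Serre1973, III §1.1 Prop. 2] -/
theorem hilbertSymbol_adicCompletion_eq_of_sub_ne_zero {a b : v.adicCompletion K} (ha : a ≠ 0) (hb : b ≠ 0)
    (hab : a - b ≠ 0) :
    hilbertSymbol (v.adicCompletion K) a b =
      hilbertSymbol (v.adicCompletion K) a (-(a - b)) * hilbertSymbol (v.adicCompletion K) b (a - b) := by
  haveI : CharZero (v.adicCompletion K) := charZero_of_injective_algebraMap (algebraMap K _).injective
  haveI : NeZero (2 : v.adicCompletion K) := ⟨two_ne_zero⟩
  have hm1 : (-1 : v.adicCompletion K) ≠ 0 := by norm_num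
  have h1 := hilbertSymbol_eq_add_neg_mul a (-b) (by rwa [← sub_eq_add_neg])
  rw [show a + -b = a - b by ring, show -(a * -b) = a * b by ring, show -b = -1 * b by ring,
    hilbertSymbol_adicCompletion_mul_right K v hm1 hb ha,
    hilbertSymbol_adicCompletion_mul_right K v ha hb hab] at h1
  rw [show -(a - b) = -1 * (a - b) by ring, hilbertSymbol_adicCompletion_mul_right K v hm1 hab ha,
    hilbertSymbol_comm b (a - b), hilbertSymbol_comm a (a - b)]
  have hsq := hilbertSymbol_mul_self_eq_one a (-1 : v.adicCompletion K)
  calc hilbertSymbol (v.adicCompletion K) a b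
      = hilbertSymbol (v.adicCompletion K) a (-1) *
          (hilbertSymbol (v.adicCompletion K) a (-1) * hilbertSymbol (v.adicCompletion K) a b) := by
        rw [← mul_assoc, hsq, one_mul]
    _ = hilbertSymbol (v.adicCompletion K) a (-1) *
          (hilbertSymbol (v.adicCompletion K) (a - b) a * hilbertSymbol (v.adicCompletion K) (a - b) b) := by
        rw [h1]
    _ = _ := by ring

/-- `(u, w)_v (u, -w)_v = (u, -1)_v` for `u, w ≠ 0` in `K_v`. [cite: Omeara1963, §63B (63:13a)] -/
theorem hilbertSymbol_adicCompletion_mul_neg {u w : v.adicCompletion K} (hu : u ≠ 0) (hw : w ≠ 0) :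
    hilbertSymbol (v.adicCompletion K) u w * hilbertSymbol (v.adicCompletion K) u (-w) =
      hilbertSymbol (v.adicCompletion K) u (-1) := by
  haveI : CharZero (v.adicCompletion K) := charZero_of_injective_algebraMap (algebraMap K _).injective
  rw [← hilbertSymbol_adicCompletion_mul_right K v hw (neg_ne_zero.mpr hw) hu,
    show w * -w = -1 * w ^ 2 by ring, hilbertSymbol_mul_sq_right _ _ hw]

/-- **The core computation.** For `a, b ≠ 0` in `K_v` with `a - b = e₂ - e₁` and distinct `e₁, e₂, e₃`:
`(a, b)_v (a, D₂)_v (b, D₁)_v = (a, e₃ - e₂)_v (b, e₃ - e₁)_v`, where `D₁ = (e₁ - e₂)(e₁ - e₃)`,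
`D₂ = (e₂ - e₁)(e₂ - e₃)`. [cite: SilvermanAEC2009, Prop. X.1.4] [cite: Omeara1963, §63B (63:13a)] -/
theorem hilbertSymbol_triple_eq_of_sub_eq {a b e₁ e₂ e₃ : v.adicCompletion K} (ha : a ≠ 0) (hb : b ≠ 0)
    (hab : a - b = e₂ - e₁) (h₁₂ : e₁ ≠ e₂) (h₁₃ : e₁ ≠ e₃) (h₂₃ : e₂ ≠ e₃) :
    hilbertSymbol (v.adicCompletion K) a b *
        hilbertSymbol (v.adicCompletion K) a ((e₂ - e₁) * (e₂ - e₃)) *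
        hilbertSymbol (v.adicCompletion K) b ((e₁ - e₂) * (e₁ - e₃)) =
      hilbertSymbol (v.adicCompletion K) a (e₃ - e₂) * hilbertSymbol (v.adicCompletion K) b (e₃ - e₁) := by
  haveI : CharZero (v.adicCompletion K) := charZero_of_injective_algebraMap (algebraMap K _).injective
  have h21 : e₂ - e₁ ≠ 0 := sub_ne_zero.mpr (Ne.symm h₁₂)
  have h12 : e₁ - e₂ ≠ 0 := sub_ne_zero.mpr h₁₂
  have h13 : e₁ - e₃ ≠ 0 := sub_ne_zero.mpr h₁₃
  have h23 : e₂ - e₃ ≠ 0 := sub_ne_zero.mpr h₂₃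
  -- (1): `(a, b) = (a, e₁ - e₂) (b, e₂ - e₁)`
  have h1 := hilbertSymbol_adicCompletion_eq_of_sub_ne_zero K v ha hb (by rw [hab]; exact h21)
  rw [hab, show -(e₂ - e₁) = e₁ - e₂ by ring] at h1
  rw [h1, hilbertSymbol_adicCompletion_mul_right K v h21 h23 ha,
    hilbertSymbol_adicCompletion_mul_right K v h12 h13 hb]
  have hA := hilbertSymbol_adicCompletion_mul_neg K v ha h12
  have hB := hilbertSymbol_adicCompletion_mul_neg K v hb h21
  rw [show -(e₁ - e₂) = e₂ - e₁ by ring] at hA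
  rw [show -(e₂ - e₁) = e₁ - e₂ by ring] at hB
  have hA' := hilbertSymbol_adicCompletion_mul_neg K v ha h23
  have hB' := hilbertSymbol_adicCompletion_mul_neg K v hb h13
  rw [show -(e₂ - e₃) = e₃ - e₂ by ring] at hA'
  rw [show -(e₁ - e₃) = e₃ - e₁ by ring] at hB'
  -- `(u, w) (u, -w) = (u, -1)`, and the `±1` values square to `1`
  have sA := hilbertSymbol_mul_self_eq_one a (-1 : v.adicCompletion K)
  have sB := hilbertSymbol_mul_self_eq_one b (-1 : v.adicCompletion K)
  have sA2 := hilbertSymbol_mul_self_eq_one a (e₂ - e₃)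
  have sB2 := hilbertSymbol_mul_self_eq_one b (e₁ - e₃)
  -- target: regroup
  calc hilbertSymbol _ a (e₁ - e₂) * hilbertSymbol _ b (e₂ - e₁) *
        (hilbertSymbol _ a (e₂ - e₁) * hilbertSymbol _ a (e₂ - e₃)) *
        (hilbertSymbol _ b (e₁ - e₂) * hilbertSymbol _ b (e₁ - e₃))
      = (hilbertSymbol _ a (e₁ - e₂) * hilbertSymbol _ a (e₂ - e₁)) *
          (hilbertSymbol _ b (e₂ - e₁) * hilbertSymbol _ b (e₁ - e₂)) *
          hilbertSymbol _ a (e₂ - e₃) * hilbertSymbol _ b (e₁ - e₃) := by ring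
    _ = hilbertSymbol _ a (-1) * hilbertSymbol _ b (-1) *
          hilbertSymbol _ a (e₂ - e₃) * hilbertSymbol _ b (e₁ - e₃) := by rw [hA, hB]
    _ = (hilbertSymbol _ a (e₂ - e₃) * hilbertSymbol _ a (e₃ - e₂) * hilbertSymbol _ a (e₂ - e₃)) *
          (hilbertSymbol _ b (e₁ - e₃) * hilbertSymbol _ b (e₃ - e₁) * hilbertSymbol _ b (e₁ - e₃)) := by
        rw [hA', hB']; ring
    _ = hilbertSymbol _ a (e₃ - e₂) * hilbertSymbol _ b (e₃ - e₁) := by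
        calc _ = (hilbertSymbol _ a (e₂ - e₃) * hilbertSymbol _ a (e₂ - e₃)) * hilbertSymbol _ a (e₃ - e₂) *
              ((hilbertSymbol _ b (e₁ - e₃) * hilbertSymbol _ b (e₁ - e₃)) * hilbertSymbol _ b (e₃ - e₁)) := by
                ring
          _ = _ := by rw [sA2, sB2, one_mul, one_mul]

/-- **The descent form vanishes at a point with `x ∉ {e₁, e₂, e₃}`**: for `x ∈ K_v` with
`a = x - e₁`, `b = x - e₂`, `c = x - e₃` non-zero and `abc` a square (a point of
`y² = (x - e₁)(x - e₂)(x - e₃)`), `(a, b)_v (a, D₂)_v (b, D₁)_v = 1`.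
Proof: the difference identity for the pairs `(a, c)`, `(b, c)` with `c ≡ ab` gives `(a, b) = (b, e₃ - e₁)
= (a, e₃ - e₂)`, and `hilbertSymbol_triple_eq_of_sub_eq`. [cite: SilvermanAEC2009, Prop. X.1.4]
[cite: PoonenRains2012, Prop. 4.8] -/
theorem hilbertSymbol_descentForm_eq_one_of_sq {x e₁ e₂ e₃ z : v.adicCompletion K} (ha : x - e₁ ≠ 0)
    (hb : x - e₂ ≠ 0) (hc : x - e₃ ≠ 0) (h₁₂ : e₁ ≠ e₂) (h₁₃ : e₁ ≠ e₃) (h₂₃ : e₂ ≠ e₃)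
    (hz : (x - e₁) * (x - e₂) * (x - e₃) = z ^ 2) :
    hilbertSymbol (v.adicCompletion K) (x - e₁) (x - e₂) *
        hilbertSymbol (v.adicCompletion K) (x - e₁) ((e₂ - e₁) * (e₂ - e₃)) *
        hilbertSymbol (v.adicCompletion K) (x - e₂) ((e₁ - e₂) * (e₁ - e₃)) = 1 := by
  haveI : CharZero (v.adicCompletion K) := charZero_of_injective_algebraMap (algebraMap K _).injective
  set a := x - e₁ with ha_def
  set b := x - e₂ with hb_def
  set c := x - e₃ with hc_def
  have h31 : e₃ - e₁ ≠ 0 := sub_ne_zero.mpr (Ne.symm h₁₃)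
  have h32 : e₃ - e₂ ≠ 0 := sub_ne_zero.mpr (Ne.symm h₂₃)
  have hz0 : z ≠ 0 := by
    rintro rfl
    rw [zero_pow two_ne_zero] at hz
    exact mul_ne_zero (mul_ne_zero ha hb) hc hz
  have hab0 : a * b ≠ 0 := mul_ne_zero ha hb
  -- `c = ab · (z/(ab))²`, so `(u, c) = (u, ab)`
  have hc_eq : c = a * b * (z / (a * b)) ^ 2 := by
    field_simp
    linear_combination hz
  have hcab : ∀ u : v.adicCompletion K, hilbertSymbol (v.adicCompletion K) u c =
      hilbertSymbol (v.adicCompletion K) u (a * b) := fun u => by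
    rw [hc_eq, hilbertSymbol_mul_sq_right _ _ (div_ne_zero hz0 hab0)]
  rw [hilbertSymbol_triple_eq_of_sub_eq K v ha hb (by rw [ha_def, hb_def]; ring) h₁₂ h₁₃ h₂₃]
  -- (2): pair `(a, c)`, `a - c = e₃ - e₁`
  have h2 := hilbertSymbol_adicCompletion_eq_of_sub_ne_zero K v ha hc
    (by rw [show a - c = e₃ - e₁ by rw [ha_def, hc_def]; ring]; exact h31)
  rw [show a - c = e₃ - e₁ by rw [ha_def, hc_def]; ring, hcab, hilbertSymbol_adicCompletion_mul_right K v ha hb ha,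
    hilbertSymbol_self_right ha, hilbertSymbol_comm c, hcab,
    hilbertSymbol_adicCompletion_mul_right K v ha hb h31, hilbertSymbol_comm (e₃ - e₁) a] at h2
  -- h2 : (a,-1)(a,b) = (a,-(e₃-e₁)) * ((a,e₃-e₁) (e₃-e₁,b))
  have hA := hilbertSymbol_adicCompletion_mul_neg K v ha h31
  -- (3): pair `(b, c)`, `b - c = e₃ - e₂`
  have h3 := hilbertSymbol_adicCompletion_eq_of_sub_ne_zero K v hb hc
    (by rw [show b - c = e₃ - e₂ by rw [hb_def, hc_def]; ring]; exact h32)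
  rw [show b - c = e₃ - e₂ by rw [hb_def, hc_def]; ring, hcab, hilbertSymbol_adicCompletion_mul_right K v ha hb hb,
    hilbertSymbol_self_right hb, hilbertSymbol_comm c, hcab,
    hilbertSymbol_adicCompletion_mul_right K v ha hb h32, hilbertSymbol_comm b a] at h3
  -- h3 : (a,b)(b,-1) = (b,-(e₃-e₂)) * ((e₃-e₂,a)(e₃-e₂,b))
  have hB := hilbertSymbol_adicCompletion_mul_neg K v hb h32
  have sA := hilbertSymbol_mul_self_eq_one a (-1 : v.adicCompletion K)
  have sB := hilbertSymbol_mul_self_eq_one b (-1 : v.adicCompletion K)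
  have sAB := hilbertSymbol_mul_self_eq_one a b
  -- from h2: (a,b) = (b, e₃-e₁)
  have e2 : hilbertSymbol (v.adicCompletion K) a b = hilbertSymbol (v.adicCompletion K) b (e₃ - e₁) := by
    have : hilbertSymbol _ a (-1) * hilbertSymbol _ a b =
        hilbertSymbol _ a (-1) * hilbertSymbol _ (e₃ - e₁) b := by
      rw [h2, ← hA]; ring
    calc hilbertSymbol _ a b = hilbertSymbol _ a (-1) * (hilbertSymbol _ a (-1) * hilbertSymbol _ a b) := by
          rw [← mul_assoc, sA, one_mul]
      _ = hilbertSymbol _ a (-1) * (hilbertSymbol _ a (-1) * hilbertSymbol _ (e₃ - e₁) b) := by rw [this]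
      _ = hilbertSymbol _ b (e₃ - e₁) := by rw [← mul_assoc, sA, one_mul, hilbertSymbol_comm]
  -- from h3: (a,b) = (a, e₃-e₂)
  have e3 : hilbertSymbol (v.adicCompletion K) a b = hilbertSymbol (v.adicCompletion K) a (e₃ - e₂) := by
    have : hilbertSymbol _ b (-1) * hilbertSymbol _ a b =
        hilbertSymbol _ b (-1) * hilbertSymbol _ (e₃ - e₂) a := by
      rw [mul_comm (hilbertSymbol _ b (-1)) (hilbertSymbol _ a b), h3, ← hB, hilbertSymbol_comm (e₃ - e₂) b]; ring
    calc hilbertSymbol _ a b = hilbertSymbol _ b (-1) * (hilbertSymbol _ b (-1) * hilbertSymbol _ a b) := by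
          rw [← mul_assoc, sB, one_mul]
      _ = hilbertSymbol _ b (-1) * (hilbertSymbol _ b (-1) * hilbertSymbol _ (e₃ - e₂) a) := by rw [this]
      _ = hilbertSymbol _ a (e₃ - e₂) := by rw [← mul_assoc, sB, one_mul, hilbertSymbol_comm]
  rw [← e2, ← e3, sAB]

/-- **`(D₁, D₂)_v = 1`** for the descent constants `D₁ = (e₁ - e₂)(e₁ - e₃)`, `D₂ = (e₂ - e₁)(e₂ - e₃)` of
distinct `e₁, e₂, e₃ ∈ K_v`: with `u = e₁ - e₂`, `w = e₁ - e₃`, `D₁ = uw`, `D₂ = u(u - w)`, and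
`(w, u - w)_v = (u, -w(u - w))_v`. (This is `Q_v(δ(T₁)) = Q_v(δ(T₂)) = 1`.)
[cite: SilvermanAEC2009, Prop. X.1.4] [cite: Omeara1963, §63B (63:13a)] -/
theorem hilbertSymbol_descentConstants_eq_one {e₁ e₂ e₃ : v.adicCompletion K} (h₁₂ : e₁ ≠ e₂) (h₁₃ : e₁ ≠ e₃)
    (h₂₃ : e₂ ≠ e₃) :
    hilbertSymbol (v.adicCompletion K) ((e₁ - e₂) * (e₁ - e₃)) ((e₂ - e₁) * (e₂ - e₃)) = 1 := by
  haveI : CharZero (v.adicCompletion K) := charZero_of_injective_algebraMap (algebraMap K _).injective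
  haveI : NeZero (2 : v.adicCompletion K) := ⟨two_ne_zero⟩
  set u := e₁ - e₂ with hu_def
  set w := e₁ - e₃ with hw_def
  have hu : u ≠ 0 := sub_ne_zero.mpr h₁₂
  have hw : w ≠ 0 := sub_ne_zero.mpr h₁₃
  have huw : u - w ≠ 0 := by
    rw [show u - w = e₃ - e₂ by rw [hu_def, hw_def]; ring]
    exact sub_ne_zero.mpr (Ne.symm h₂₃)
  have hD2 : (e₂ - e₁) * (e₂ - e₃) = u * (u - w) := by rw [hu_def, hw_def]; ring
  rw [hD2]
  have key := hilbertSymbol_eq_add_neg_mul w (u - w) (by rw [add_sub_cancel]; exact hu)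
  rw [add_sub_cancel] at key
  -- expand `(uw, u(u-w))`
  rw [hilbertSymbol_adicCompletion_mul_left K v hu hw (mul_ne_zero hu huw),
    hilbertSymbol_adicCompletion_mul_right K v hu huw hu, hilbertSymbol_adicCompletion_mul_right K v hu huw hw,
    hilbertSymbol_self_right hu, key, hilbertSymbol_comm w u]
  have s := hilbertSymbol_mul_self_eq_one u w
  have hm1 : (-1 : v.adicCompletion K) ≠ 0 := by norm_num
  -- `(u,-1)(u,u-w)(u,-(w(u-w))) = (u, w (u-w)²) = (u, w)`
  have e : hilbertSymbol (v.adicCompletion K) u (-1) * hilbertSymbol (v.adicCompletion K) u (u - w) *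
      hilbertSymbol (v.adicCompletion K) u (-(w * (u - w))) = hilbertSymbol (v.adicCompletion K) u w := by
    rw [← hilbertSymbol_adicCompletion_mul_right K v hm1 huw hu,
      ← hilbertSymbol_adicCompletion_mul_right K v (mul_ne_zero hm1 huw) (neg_ne_zero.mpr (mul_ne_zero hw huw)) hu,
      show -1 * (u - w) * -(w * (u - w)) = w * (u - w) ^ 2 by ring, hilbertSymbol_mul_sq_right _ _ huw]
  calc hilbertSymbol _ u (-1) * hilbertSymbol _ u (u - w) * (hilbertSymbol _ u w * hilbertSymbol _ u (-(w * (u - w))))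
      = (hilbertSymbol _ u (-1) * hilbertSymbol _ u (u - w) * hilbertSymbol _ u (-(w * (u - w)))) * hilbertSymbol _ u w := by
        ring
    _ = 1 := by rw [e, s]

end Local

/-! ## The form vanishes on the local Kummer image -/

section Points

variable {K : Type} [Field K] [NumberField K] (v : HeightOneSpectrum (𝓞 K))
variable (W : WeierstrassCurve K) {e₁ e₂ e₃ : K}

/-- **The Hilbert-symbol Tate quadratic form vanishes on the local Kummer image** (every finite place,
dyadic included).  For `P ∈ E(K_v)` with descent components `x(P) - e₁ ≡ A`, `x(P) - e₂ ≡ B` in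
`K_vˣ/K_vˣ²` (the conventions of `twoDescentComponent` at `O, T₁, T₂`):
`(A, B)_v · (A, D₂)_v · (B, D₁)_v = 1`, `D₁ = (e₁ - e₂)(e₁ - e₃)`, `D₂ = (e₂ - e₁)(e₂ - e₃)`.  This is
"`q_v` vanishes on `H¹_𝒮(K_v, E[2])`" (KMR Def. 3.8) for the explicit form `Q_v`; since `D₁, D₂` scale by
`d²` under the quadratic twist by `d`, the SAME form serves every twist.
[cite: KlagsbrunMazurRubin2013, Def. 3.8] [cite: PoonenRains2012, Prop. 4.8, Prop. 4.10]
[cite: SilvermanAEC2009, Prop. X.1.4] -/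
theorem hilbertSymbol_twoDescentComponent_pair_eq_one (h : W.toAffine.SplitTwoTorsion e₁ e₂ e₃)
    [(W.baseChange (v.adicCompletion K)).IsElliptic] (P : (W.baseChange (v.adicCompletion K)).toAffine.Point)
    (A B : (v.adicCompletion K)ˣ)
    (hA : twoDescentComponent (W.baseChange (v.adicCompletion K)).toAffine (algebraMap K _ e₁) (algebraMap K _ e₂)
        (algebraMap K _ e₃) P = QuotientGroup.mk A)
    (hB : twoDescentComponent (W.baseChange (v.adicCompletion K)).toAffine (algebraMap K _ e₂) (algebraMap K _ e₁)
        (algebraMap K _ e₃) P = QuotientGroup.mk B) :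
    hilbertSymbol (v.adicCompletion K) (A : v.adicCompletion K) B *
        hilbertSymbol (v.adicCompletion K) (A : v.adicCompletion K) (algebraMap K _ ((e₂ - e₁) * (e₂ - e₃))) *
        hilbertSymbol (v.adicCompletion K) (B : v.adicCompletion K) (algebraMap K _ ((e₁ - e₂) * (e₁ - e₃))) = 1 := by
  haveI : CharZero (v.adicCompletion K) := charZero_of_injective_algebraMap (algebraMap K _).injective
  have h' := h.map (v.adicCompletion K)
  set f₁ := algebraMap K (v.adicCompletion K) e₁ with hf₁
  set f₂ := algebraMap K (v.adicCompletion K) e₂ with hf₂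
  set f₃ := algebraMap K (v.adicCompletion K) e₃ with hf₃
  have hD₂ : algebraMap K (v.adicCompletion K) ((e₂ - e₁) * (e₂ - e₃)) = (f₂ - f₁) * (f₂ - f₃) := by
    simp only [map_mul, map_sub, hf₁, hf₂, hf₃]
  have hD₁ : algebraMap K (v.adicCompletion K) ((e₁ - e₂) * (e₁ - e₃)) = (f₁ - f₂) * (f₁ - f₃) := by
    simp only [map_mul, map_sub, hf₁, hf₂, hf₃]
  rw [hD₁, hD₂]
  have n12 := h'.ne₁₂
  have n13 := h'.ne₁₃
  have n23 := h'.ne₂₃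
  have hD₁0 : (f₁ - f₂) * (f₁ - f₃) ≠ 0 := h'.c_ne_zero
  have hD₂0 : (f₂ - f₁) * (f₂ - f₃) ≠ 0 := h'.swap₁₂.c_ne_zero
  have hDD := hilbertSymbol_descentConstants_eq_one K v n12 n13 n23
  rcases P with _ | ⟨x, y, hP⟩
  · -- `P = O`: both components trivial
    have hA1 : (QuotientGroup.mk A : SqUnits (v.adicCompletion K)) = 1 := by rw [← hA]; rfl
    have hB1 : (QuotientGroup.mk B : SqUnits (v.adicCompletion K)) = 1 := by rw [← hB]; rfl
    rw [hilbertSymbol_eq_one_of_mk_eq_one hA1, hilbertSymbol_eq_one_of_mk_eq_one hA1,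
      hilbertSymbol_eq_one_of_mk_eq_one hB1]
    norm_num
  · by_cases hx1 : x = f₁
    · -- `P = ±T₁`
      rw [twoDescentComponent_some_of_eq hP hx1] at hA
      rw [twoDescentComponent_some_of_ne hP (by rw [hx1]; exact n12), hx1] at hB
      rw [hilbertSymbol_eq_of_mk_eq_sqClass hD₁0 hA.symm, hilbertSymbol_eq_of_mk_eq_sqClass hD₁0 hA.symm,
        hilbertSymbol_eq_of_mk_eq_sqClass (sub_ne_zero.mpr n12) hB.symm,
        hilbertSymbol_comm ((f₁ - f₂) * (f₁ - f₃)) (B : v.adicCompletion K),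
        hilbertSymbol_eq_of_mk_eq_sqClass (sub_ne_zero.mpr n12) hB.symm, hDD, mul_one,
        hilbertSymbol_mul_self_eq_one]
    · by_cases hx2 : x = f₂
      · -- `P = ±T₂`
        rw [twoDescentComponent_some_of_ne hP hx1, hx2] at hA
        rw [twoDescentComponent_some_of_eq hP hx2] at hB
        rw [hilbertSymbol_eq_of_mk_eq_sqClass (sub_ne_zero.mpr (Ne.symm n12)) hA.symm,
          hilbertSymbol_eq_of_mk_eq_sqClass (sub_ne_zero.mpr (Ne.symm n12)) hA.symm,
          hilbertSymbol_eq_of_mk_eq_sqClass hD₂0 hB.symm,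
          hilbertSymbol_comm (f₂ - f₁) (B : v.adicCompletion K),
          hilbertSymbol_eq_of_mk_eq_sqClass hD₂0 hB.symm, hilbertSymbol_comm (f₂ - f₁) ((f₂ - f₁) * (f₂ - f₃)),
          hilbertSymbol_mul_self_eq_one, one_mul, hilbertSymbol_comm, hDD]
      · -- generic abscissa (including `±T₃`)
        rw [twoDescentComponent_some_of_ne hP hx1] at hA
        rw [twoDescentComponent_some_of_ne hP hx2] at hB
        have ha : x - f₁ ≠ 0 := sub_ne_zero.mpr hx1
        have hb : x - f₂ ≠ 0 := sub_ne_zero.mpr hx2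
        rw [hilbertSymbol_eq_of_mk_eq_sqClass ha hA.symm, hilbertSymbol_eq_of_mk_eq_sqClass ha hA.symm,
          hilbertSymbol_comm (x - f₁) (B : v.adicCompletion K),
          hilbertSymbol_eq_of_mk_eq_sqClass hb hB.symm, hilbertSymbol_eq_of_mk_eq_sqClass hb hB.symm,
          hilbertSymbol_comm (x - f₂) (x - f₁)]
        by_cases hx3 : x = f₃
        · -- `P = ±T₃`: `a = e₃ - e₁`, `b = e₃ - e₂`
          rw [hilbertSymbol_triple_eq_of_sub_eq K v ha hb (by ring) n12 n13 n23, hx3, hilbertSymbol_comm (f₃ - f₂),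
            hilbertSymbol_mul_self_eq_one]
        · have hsq := sq_eq_mul_mul_of_equation h' hP.left
          exact hilbertSymbol_descentForm_eq_one_of_sq K v ha hb (sub_ne_zero.mpr hx3) n12 n13 n23 hsq.symm

end Points

/-! ## Classes in the local Selmer condition -/

section Selmer

variable {K : Type} [Field K] [NumberField K] (v : HeightOneSpectrum (𝓞 K))
variable (W : WeierstrassCurve K) [W.IsElliptic] {e₁ e₂ e₃ : K}

/-- **The Hilbert-symbol Tate quadratic form vanishes on the local Selmer condition at `v`.**  For a class
`c ∈ H¹(K, E[2])` satisfying the local Selmer condition at the finite place `v` (`c ∈ selmerLocalKer W K_v 2`,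
the preimage of the local Kummer condition, `comap_res_kummerLocalConditionAt`), with global components
`[a], [b] ∈ Kˣ/Kˣ²`:  `(a, b)_v · (a, D₂)_v · (b, D₁)_v = 1`, `D₁ = (e₁ - e₂)(e₁ - e₃)`, `D₂ = (e₂ - e₁)(e₂ - e₃)`
(the class is locally the descent pair of a point of `E(K_v)`, tree `exists_twoDescentComponent_pair_eq_of_res_mem`, and
`hilbertSymbol_twoDescentComponent_pair_eq_one`).  This is KMR's "`q_v(c_v) = 0` for `c_v ∈ H¹_𝒮(K_v, T)`" at every
place of the Selmer structure, for the explicit form `Q_v`.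
[cite: KlagsbrunMazurRubin2013, Def. 3.8] [cite: PoonenRains2012, Prop. 4.8, Prop. 4.10] [cite: SilvermanAEC2009, Prop. X.1.4, Prop. X.4.9] -/
theorem hilbertSymbol_descentForm_eq_one_of_mem_selmerLocalKer (h : W.toAffine.SplitTwoTorsion e₁ e₂ e₃)
    [(W.baseChange (v.adicCompletion K)).IsElliptic] {c : galH1Torsion W 2}
    (hc : c ∈ selmerLocalKer W (v.adicCompletion K) 2) (a b : Kˣ)
    (ha : GaloisRepresentations.kummerEquiv K 2 (W.twoTorsionCharH1 h c) = Additive.ofMul (QuotientGroup.mk a))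
    (hb : GaloisRepresentations.kummerEquiv K 2 (W.twoTorsionCharH1 h.swap₁₂ c) = Additive.ofMul (QuotientGroup.mk b)) :
    hilbertSymbol (v.adicCompletion K) (algebraMap K _ (a : K)) (algebraMap K _ (b : K)) *
        hilbertSymbol (v.adicCompletion K) (algebraMap K _ (a : K)) (algebraMap K _ ((e₂ - e₁) * (e₂ - e₃))) *
        hilbertSymbol (v.adicCompletion K) (algebraMap K _ (b : K)) (algebraMap K _ ((e₁ - e₂) * (e₁ - e₃))) = 1 := by
  haveI : CharZero (v.adicCompletion K) := charZero_of_injective_algebraMap (algebraMap K _).injective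
  have hc' : GaloisRepresentations.galoisCohomology.res (W.torsionGaloisModule 2) (v.adicCompletion K) 1 c ∈
      W.kummerLocalConditionAt 2 (v.adicCompletion K) := by
    have := hc
    rw [← W.comap_res_kummerLocalConditionAt] at this
    exact this
  obtain ⟨P, hPa, hPb⟩ :=
    W.exists_twoDescentComponent_pair_eq_of_res_mem (v.adicCompletion K) h hc' a b ha hb
  have key := hilbertSymbol_twoDescentComponent_pair_eq_one v W h P
    (Units.map (algebraMap K (v.adicCompletion K) : K →* v.adicCompletion K) a)
    (Units.map (algebraMap K (v.adicCompletion K) : K →* v.adicCompletion K) b) hPa hPb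
  simpa only [Units.coe_map, MonoidHom.coe_coe] using key

end Selmer

end Literature.NumberTheory.EllipticCurves.TwoDescentHilbert

end
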